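import Summits.QuantumFields.BalabanUV.T4Continuum.Spine.NE1p.DressedRootSameLattice
import Summits.QuantumFields.BalabanUV.T4Continuum.Spine.NE1p.DressedCompositionWitness

/-!
# T⁴ programme, spine estimate NE1′ (node O3b/H2) — crew row W21: THE SAME-LATTICE FACE FIRES AT THE INTEGER `L = 2`
# WITH LIVE PER-GENERATION RADII (a decided witness for the owner's face N0f `DressedRootSameLattice`)

Cell `pub-balaban`, sub-cell `t4`, BINDER-OWNERS row NE1′; NE1′ formalisation crew, unit `b2b-balaban-t4-ne1p-formalise-leaf-10`
(gen 4); typer booking R-T80 (v).  REUSE lane: imports the owner face N0f `Spine/NE1p/DressedRootSameLattice` (p218843) and the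
crew witness W18 `Spine/NE1p/DressedCompositionWitness` (p218795) ONLY; W18's tower datum `towerC`∕`BC`∕`TC`∕`SC`∕`gC`∕`sizeC`∕`defC`
and its binders `hbirth_C`∕`hreg_C`∕`hS_C`∕`hcount_C`∕`positionalCount_C`∕`hdefw_C`∕`cell_at_two` are used BY NAME (nothing copied).

WHAT IS NEW.  N0f's ROOT-C face `dressedStabilityStrict_of_sameLattice` displays, per generation `(b, k′)`, ITS OWN window norm,
window and chart RADIUS (`hr`), ONE carried function with NO later-scale index, its birth slice AT THE BIRTH SCALE ONLY (`hsl`), and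
the attaining pairs' defect NORMALISED to the generation's radius, `defect ≤ c_δ·r·(L⁻²)^(k−k′)` (`hrate`) — the place where the
K-freeness of the transport constant `U.C = 4·c_δ` lives (cross-read X90, INFO-1).  W18 fires the composition face N0e with ONE
COMMON radius `r = 1`; on W18's chart N0f's per-generation radius would stay idle.  Here the radius is LIVE: `rS k′ = (1/2)^k′`
SHRINKS geometrically (`radius_live`, `no_common_radius`), so the UN-normalised chart constant `4/r` is unbounded along the
generations (`chartConstant_unbounded` — N0e's common-`r` face cannot be fed on this chart family with a generation-free `4c_δ/r`;
N0f's normalised `4c_δ` is); window `rS k′`, base set `closedBall 0 (rS k′)`, ONE carried function per generation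
`FnS K b k′ U = (gC K b / rS b)·U` (slope `∝ 1/radius`, so on the SCALED slice domain `‖U + t·d‖ ≤ 3·rS k′` the sup is W18's
`3·gC = gen b b`, SHARP — `hsl_S`, at birth only); the NORMALISED defect `defS k′ k = rS k′·(1/4)^(k−k′)` (`hrate_S` with EQUALITY
at `c_δ = 1`, `hdefw_S` from W18's `defC ≤ 1`); `hlin_S` ATTAINED WITHOUT SLACK by the pair `(0, defS k′ k)` —
`(gC/rS)·(rS·defC) = gC·defC = sizeC` (`linS_eq_response`): the radius CANCELS on the datum exactly as in N0f §1.
SIBLING (v1.1, typer R-T81 (ii) condition (h)).  The owner's (t5) witness N0h `Spine/NE1p/DressedRootSameLatticeWitness` (p219111)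
fires the same face with ONE generation born at scale `0`, base `{0}` and a CONSTANT radius `r = 1` (window `1`, `c_δ = 1/4`); the
delta of THIS file is the LIVE per-generation radius `rS k′ = (1/2)^k′ → 0` over all `K+1` generations, slopes and defects scaled to it.

SCALARS (K-∕μ-free, ONE set): `L = 2` (the integer), continuation factor `≡ 1` (no binder on this face), `c_δ = 1` ⇒ `U.C = 4`
radius-free, `c̄ = 0`, `N₀ = A₀ = 1`, `m = 1/2`, `s̄⁰ = 0`, `ρ′ = 1/2` — W18's `cell_at_two` BY NAME (`div_one`).  END
`sameLatticeFace_fires : (∀ r₀ > 0, ∃ k′, rS k′ < r₀) ∧ DressedStabilityStrict towerC ((2:ℝ)^4)` — second conjunct = N0f's face BY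
NAME, ONE application (ROOT-C OF RECORD; Λ = `(2:ℝ)^4` = the rate of `hcount_C`, k4), conjoined with the liveness because the bare
ROOT-C on `towerC` is W18's `dressedStabilityStrict_towerC`; bare ROOT-C, headline, ROOT-B via N0f's corollaries as `example`s.
`rel := Eq` (`hinv_S` trivial — the gauge-quotient and (w5) corners are row W19's).

HONEST FRAMING.  The owner's same-lattice face fires on ONE decided datum at `L = 2` with radii shrinking to `0` — a toy chart family
on the complex line, NOT Bałaban's small-field charts; nothing of Bałaban's densities, minimisers or value maps is modelled; (VAL-θ),
(w1), (w5)∕(w5b), (I4′), PAY untouched as estimates; the same-lattice READING and wall «v1.5-proposed» remain the owner's (Q42 (b1),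
t4-ref2, pending).  «ROOT-C fires on a toy», never «NE1′ proved».  NE1′ NOT printed, NOT proved; spine PROVED 0∕9.  Rung (B)+1 on ONE
finite four-torus — NOT infinite volume, NOT a mass gap, NOT OS on ℝ⁴, NOT Clay.  HONEST DEPENDENCY: continuum YM on T⁴ ⇐ BetaPertH ∧
nine spine estimates (0/9 proved); BetaPertH ⇐ (D1) ∧ (D4) ∧ CAP+tail; G-an2-4 gates asym, D1 and NE2/3/4.
-/

noncomputable section

namespace Summit.QuantumFields.BalabanUV.T4Continuum.NE1p.DressedSameLatticeWitness

open Finset Metric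
open scoped BigOperators
open Literature.MathematicalPhysics.QuantumFieldTheory.Balaban1983to89
open T4TermFormat T4TermFormat.Booking T4TrajectoryComparison
open T4BirthChartTransport (GaugeInvariant BirthSlice RelGauge)
open Summit.QuantumFields.BalabanUV.T4Continuum.T4TrajectoryDensityDressed Summit.QuantumFields.BalabanUV.T4Continuum.NE1p
open DressedRoot DressedUniformConstants DressedRootSameLattice DressedCompositionWitness

/-! ## §1 The live per-generation chart data -/

/-- RADIUS (= window) of generation `k′`'s birth chart [decided toy]: `rS k′ = (1/2)^k′` SHRINKS — the per-generation radius is live. [folklore] -/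
def rS (k' : ℕ) : ℝ := (1 / 2 : ℝ) ^ k'

/-- Radii are positive (N0f's binder `hr`). [folklore] -/
theorem rS_pos (k' : ℕ) : 0 < rS k' := by unfold rS; positivity

/-- **THE RADIUS IS LIVE** [decided toy]: every positive number is undercut by some generation's radius — the radii have NO positive
common lower bound along the generations (hence none uniform in the cutoff). [folklore] -/
theorem radius_live : ∀ r₀ : ℝ, 0 < r₀ → ∃ k' : ℕ, rS k' < r₀ :=
  fun _ hr₀ => exists_pow_lt_of_lt_one hr₀ (by norm_num : (1 / 2 : ℝ) < 1)

/-- … so NO single positive radius serves every generation (N0e's common-radius face cannot display this chart family). [folklore] -/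
theorem no_common_radius : ¬ ∃ r₀ : ℝ, 0 < r₀ ∧ ∀ k' : ℕ, r₀ ≤ rS k' := by
  rintro ⟨r₀, hr₀, h⟩
  obtain ⟨k', hk'⟩ := radius_live r₀ hr₀
  exact absurd (h k') (not_le.mpr hk')

/-- … and the UN-normalised chart constant `4/r` (N0e's `4·c_δ/r` at `c_δ = 1`) is UNBOUNDED along the generations. [folklore] -/
theorem chartConstant_unbounded : ∀ C : ℝ, ∃ k' : ℕ, C < 4 / rS k' := by
  intro C
  by_cases hC : 0 < C
  · obtain ⟨k', hk'⟩ := radius_live (4 / C) (by positivity)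
    refine ⟨k', ?_⟩
    rw [lt_div_iff₀ (rS_pos k')]
    have h := (lt_div_iff₀ hC).mp hk'
    linarith [mul_comm (rS k') C]
  · exact ⟨0, lt_of_le_of_lt (not_lt.mp hC) (div_pos (by norm_num) (rS_pos 0))⟩

/-- NORMALISED FRESH-PAIR DEFECT [decided toy]: `defS k′ k = rS k′ · (1/4)^(k−k′)` — W18's `defC` SCALED by the radius. [folklore] -/
def defS (k' k : ℕ) : ℝ := rS k' * defC k' k

/-- Normalised defects are positive. [folklore] -/
theorem defS_pos (k' k : ℕ) : 0 < defS k' k := by unfold defS; exact mul_pos (rS_pos k') (defC_pos k' k)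

/-- THE CARRIED FUNCTION of generation `k′` of family `b` — ONE function, NO later-scale index [decided toy]: the birth generation is
the linear map `U ↦ (gC K b / rS b)·U` (W18's slope DIVIDED BY THE GENERATION'S RADIUS); later generations absent. [folklore] -/
def FnS (K : ℕ) (b : Fin (K + 1)) (k' : ℕ) (U : ℂ) : ℂ :=
  if k' = b.val then ((gC K b.val / rS b.val : ℝ) : ℂ) * U else 0

/-- The carried function of the birth generation is NON-CONSTANT (the transport binders are exercised non-vacuously). [folklore] -/
theorem FnS_nonconst (K : ℕ) (b : Fin (K + 1)) : FnS K b b.val 1 ≠ FnS K b b.val 0 := by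
  unfold FnS
  rw [if_pos rfl, if_pos rfl, mul_one, mul_zero]
  exact_mod_cast (div_pos (gC_pos K b.val) (rS_pos b.val)).ne'

/-- **THE RADIUS CANCELS ON THE DATUM**: the booked size IS the response to the NORMALISED pair `(0, defS b k)` —
`(gC/rS)·(rS·defC) = gC·defC = sizeC`, attainment without slack. [folklore] -/
theorem linS_eq_response (K : ℕ) (b : Fin (K + 1)) (k : ℕ) :
    sizeC K b.val k = ‖FnS K b b.val (defS b.val k : ℂ) - FnS K b b.val 0‖ := by
  unfold FnS
  rw [if_pos rfl, if_pos rfl, mul_zero, sub_zero, norm_mul, Complex.norm_real, Complex.norm_real,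
    Real.norm_of_nonneg (div_pos (gC_pos K b.val) (rS_pos b.val)).le, Real.norm_of_nonneg (defS_pos b.val k).le]
  have hr : rS b.val ≠ 0 := (rS_pos b.val).ne'
  unfold defS sizeC defC
  field_simp

/-! ## §2 The same-lattice face's transport binders, discharged on the datum -/

/-- `hsl` AT THE BIRTH SCALE ONLY, NON-VACUOUSLY: a `BirthSlice` of `FnS K b k′` along the affine chart of ℂ in the generation's OWN
window∕radius `rS k′`, regular set `closedBall 0 (rS k′)`, sup `gen b k′` — for the birth generation the SHARP bound `3·gC` of the
scaled linear map on the scaled slice domain `‖U + t·d‖ ≤ 3·rS k′`. [folklore] -/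
theorem hsl_S (K : ℕ) : ∀ (b : (BC K).Birth) (k' : ℕ), (BC K).birthScale b ≤ k' → k' ≤ (BC K).K →
    RanBelow (budgetGate (TC K) (fun _ _ => (0 : ℝ)) (1 / 2) (SC K) (4 * 1) (fun _ : ℕ => ((2 : ℝ) ^ 2)⁻¹ * 1)) k' →
    BirthSlice (FnS K b k') (fun U d t => U + t * d) (fun d : ℂ => ‖d‖) (closedBall (0 : ℂ) (rS k')) (rS k') (rS k')
      ((TC K).gen b k') := by
  intro b k' _ _ _ U hU d hd hdw
  show ∃ Dm : Set ℂ, DifferentiableOn ℂ (fun t : ℂ => FnS K b k' (U + t * d)) Dm ∧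
      (∀ t ∈ Dm, ‖FnS K b k' (U + t * d)‖ ≤ (if k' = b.val then 3 * gC K b.val else 0)) ∧
      ∀ s ∈ Set.Icc (0 : ℝ) 1, closedBall (s : ℂ) (rS k' / ‖d‖) ⊆ Dm
  by_cases hk' : k' = b.val
  · refine ⟨closedBall (0 : ℂ) (1 + rS k' / ‖d‖), ?_, ?_, ?_⟩
    · unfold FnS
      simp only [if_pos hk']
      exact ((differentiable_const _).mul ((differentiable_const _).add
        (differentiable_id.mul (differentiable_const _)))).differentiableOn
    · intro t ht
      rw [if_pos hk']
      unfold FnS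
      have hcoef : 0 ≤ gC K b.val / rS b.val := (div_pos (gC_pos K b.val) (rS_pos b.val)).le
      rw [if_pos hk', norm_mul, Complex.norm_real, Real.norm_of_nonneg hcoef]
      have htd : ‖t‖ * ‖d‖ ≤ (1 + rS k' / ‖d‖) * ‖d‖ :=
        mul_le_mul_of_nonneg_right (mem_closedBall_zero_iff.mp ht) (norm_nonneg d)
      rw [add_mul, one_mul, div_mul_cancel₀ _ hd.ne'] at htd
      have h3 : ‖U + t * d‖ ≤ 3 * rS k' :=
        calc ‖U + t * d‖ ≤ ‖U‖ + ‖t‖ * ‖d‖ := (norm_add_le _ _).trans (by rw [norm_mul])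
          _ ≤ rS k' + (‖d‖ + rS k') := add_le_add (mem_closedBall_zero_iff.mp hU) htd
          _ ≤ 3 * rS k' := by linarith
      rw [hk'] at h3
      have hr0 : rS b.val ≠ 0 := (rS_pos b.val).ne'
      calc gC K b.val / rS b.val * ‖U + t * d‖ ≤ gC K b.val / rS b.val * (3 * rS b.val) :=
            mul_le_mul_of_nonneg_left h3 hcoef
        _ = 3 * gC K b.val := by field_simp
    · intro s hs t ht
      rw [mem_closedBall, dist_eq_norm] at ht
      have h2 : ‖(s : ℂ)‖ ≤ 1 := by rw [Complex.norm_real, Real.norm_of_nonneg hs.1]; exact hs.2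
      rw [mem_closedBall_zero_iff]
      calc ‖t‖ = ‖t - (s : ℂ) + (s : ℂ)‖ := by rw [sub_add_cancel]
        _ ≤ ‖t - (s : ℂ)‖ + ‖(s : ℂ)‖ := norm_add_le _ _
        _ ≤ rS k' / ‖d‖ + 1 := add_le_add ht h2
        _ = 1 + rS k' / ‖d‖ := add_comm _ _
  · refine ⟨Set.univ, ?_, ?_, fun _ _ => Set.subset_univ _⟩
    · unfold FnS
      simp only [if_neg hk']
      exact differentiableOn_const 0
    · intro t _
      unfold FnS
      simp [hk']

/-- `hrate` with EQUALITY — the defect NORMALISED to the generation's radius: `defS k′ k = 1 · rS k′ · ((2²)⁻¹)^(k−k′)`. [folklore] -/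
theorem hrate_S (K : ℕ) : ∀ (b : (BC K).Birth) (k' k : ℕ), (BC K).birthScale b ≤ k' → k' ≤ k → k ≤ (BC K).K →
    defS k' k ≤ 1 * rS k' * (((2 : ℝ) ^ 2)⁻¹) ^ (k - k') := by
  intro b k' k _ _ _
  have h4 : ((2 : ℝ) ^ 2)⁻¹ = 1 / 4 := by norm_num
  rw [h4, one_mul]
  unfold defS defC
  exact le_rfl

/-- `hdefw`: every normalised defect is inside the generation's window `rS k′` (`defC ≤ 1`, W18's `hdefw_C`). [folklore] -/
theorem hdefw_S (k' k : ℕ) : defS k' k ≤ rS k' := by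
  unfold defS
  exact mul_le_of_le_one_right (rS_pos k').le (hdefw_C k' k)

/-- `hlin` ATTAINED: the booked size of generation `(b, k′)` at scale `k` is realised — with NO slack — by the pair `U₀ = 0`,
`U₁ = 0 + 1·defS k′ k` (a real direction of norm exactly the NORMALISED defect). [folklore] -/
theorem hlin_S (K : ℕ) : ∀ (b : (BC K).Birth) (k' k : ℕ), (BC K).birthScale b ≤ k' → k' ≤ k → k ≤ (BC K).K →
    RanBelow (budgetGate (TC K) (fun _ _ => (0 : ℝ)) (1 / 2) (SC K) (4 * 1) (fun _ : ℕ => ((2 : ℝ) ^ 2)⁻¹ * 1)) k →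
    ∀ ε > 0, ∃ U₀ ∈ closedBall (0 : ℂ) (rS k'), ∃ U₁ : ℂ,
      RelGauge (fun U U' : ℂ => U = U') (fun U d t => U + t * d) (fun d : ℂ => ‖d‖) U₀ U₁ (defS k' k) ∧
        (TC K).lin b k' k ≤ ‖FnS K b k' U₁ - FnS K b k' U₀‖ + ε := by
  intro b k' k _ _ _ _ ε hε
  have hnorm : ‖(defS k' k : ℂ)‖ = defS k' k := by
    rw [Complex.norm_real, Real.norm_of_nonneg (defS_pos k' k).le]
  refine ⟨0, mem_closedBall_self (rS_pos k').le, 0 + 1 * (defS k' k : ℂ),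
    ⟨(defS k' k : ℂ), by show 0 < ‖(defS k' k : ℂ)‖; rw [hnorm]; exact defS_pos k' k,
      by show ‖(defS k' k : ℂ)‖ ≤ defS k' k; rw [hnorm], rfl⟩, ?_⟩
  show (if k' = b.val then sizeC K b.val k else 0) ≤ ‖FnS K b k' (0 + 1 * (defS k' k : ℂ)) - FnS K b k' 0‖ + ε
  by_cases hk' : k' = b.val
  · rw [if_pos hk', zero_add, one_mul, hk', ← linS_eq_response K b k]
    exact le_add_of_nonneg_right hε.le
  · rw [if_neg hk']
    positivity

/-- `hinv`: the carried functions are invariant under the (trivial) relation `=` (the gauge-quotient corner is row W19's). [folklore] -/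
theorem hinv_S (K : ℕ) (b : (BC K).Birth) (k' : ℕ) : GaugeInvariant (fun U U' : ℂ => U = U') (FnS K b k') :=
  fun _ _ h => by rw [h]

/-- (w1)+(w5b) `hbirth` = W18's `hbirth_C` BY NAME in the currency `4·c_δ = 4·1` (W18 writes N0e's `4·1/1`; `div_one`). [folklore] -/
theorem hbirth_S (K : ℕ) : (TC K).BirthsFromOld (4 * 1) (fun _ : ℕ => ((2 : ℝ) ^ 2)⁻¹ * 1)
    (twoRate 1 (rhoOneOf ((2 : ℝ) ^ 2)⁻¹ 1 (4 * 1) 0) ((2 : ℝ)⁻¹ ^ 3) (BC K).K)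
    (budgetGate (TC K) (fun _ _ => (0 : ℝ)) (1 / 2) (SC K) (4 * 1) (fun _ : ℕ => ((2 : ℝ) ^ 2)⁻¹ * 1)) := by
  have h := hbirth_C K
  simp only [div_one] at h
  exact h

/-- (w5) `hreg` = W18's `hreg_C` BY NAME (births only, `c ≡ 0`; currency `4·1`). [folklore] -/
theorem hreg_S (K : ℕ) : (TC K).RegeneratesFromVar (fun _ : ℕ => (0 : ℝ))
    (budgetGate (TC K) (fun _ _ => (0 : ℝ)) (1 / 2) (SC K) (4 * 1) (fun _ : ℕ => ((2 : ℝ) ^ 2)⁻¹ * 1)) := by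
  have h := hreg_C K
  simp only [div_one] at h
  exact h

/-! ## §3 The END: the same-lattice face of the owner fires at `L = 2` with live radii -/

/-- **THE CELL AT `L = 2`, DECIDED**: `locOf 2 1 (4·1) 0 = 1/2 ≤ ρ′ = 1/2 < 1` and the (w6) window, TIGHT — W18's `cell_at_two` BY
NAME, read in the same-lattice currency `4·c_δ = 4·1` (W18 writes N0e's `4·1/1`; `div_one`). [folklore] -/
theorem cell_sameLattice_at_two :
    locOf 2 1 (4 * 1) 0 = 1 / 2 ∧ (1 / 2 : ℝ) < 1 ∧ (1 / 2 : ℝ) * (1 * 1 * (1 - 1 / 2)⁻¹) ≤ 1 - 0 := by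
  have h := cell_at_two
  simp only [div_one] at h
  exact ⟨h.1, by norm_num, h.2.2⟩

/-- **THE SAME-LATTICE FACE OF THE OWNER FIRES AT THE INTEGER `L = 2` WITH LIVE PER-GENERATION RADII** [decided toy]: the radii
`rS k′ = (1/2)^k′` undercut every positive number, AND `DressedStabilityStrict towerC ((2:ℝ)^4)` by N0f `dressedStabilityStrict_of_sameLattice`
BY NAME, ONE application (`L = 2, c_δ = 1, c̄ = 0, N₀ = A₀ = 1, m = 1/2, s̄⁰ = 0, ρ′ = 1/2`; window = radius = `rS k′`, regular set
`closedBall 0 (rS k′)`, ONE carried function per generation, normalised defects `defS`) — `hsl_S`∕`hrate_S`∕`hdefw_S`∕`hlin_S`∕`hr`∕`hbirth_S`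
NON-VACUOUS, counts∕regeneration by W18's lemmas.  Λ PIN: `Λ = L^4 = 16` = the rate of `hcount_C`.  Nothing of Bałaban's. [folklore] -/
theorem sameLatticeFace_fires :
    (∀ r₀ : ℝ, 0 < r₀ → ∃ k' : ℕ, rS k' < r₀) ∧ DressedStabilityStrict towerC ((2 : ℝ) ^ 4) :=
  ⟨radius_live, dressedStabilityStrict_of_sameLattice towerC (L := 2) (cδ := 1) (cbar := 0) (N₀ := 1) (A₀ := 1)
      (m := 1 / 2) (sbar := 0) (ρ' := 1 / 2) (move := fun U d t : ℂ => U + t * d)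
      (by norm_num) zero_le_one le_rfl zero_le_one zero_le_one (by norm_num)
      cell_sameLattice_at_two.1.le cell_sameLattice_at_two.2.1 cell_sameLattice_at_two.2.2
      (fun _ _ _ => 0) (fun _ _ _ _ => 0) (fun _ K => SC K)
      (fun _ _ _ => le_rfl) (fun _ _ _ _ => le_rfl) (fun _ K => hS_C K) (fun _ K => hcount_C K) (fun _ _ _ _ => le_rfl)
      (fun _ K => hbirth_S K) (fun _ K => hreg_S K)
      (fun _ K => FnS K) (fun _ _ _ _ U U' => U = U') (fun _ _ _ k' => closedBall (0 : ℂ) (rS k'))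
      (fun _ _ _ _ d => ‖d‖) (fun _ _ _ k' => rS k') (fun _ _ _ k' => rS k') (fun _ _ _ k' k => defS k' k)
      (fun _ K => hinv_S K) (fun _ K => hsl_S K) (fun U d => by simp) (fun _ _ _ k' => rS_pos k')
      (fun _ _ _ k' k => hdefw_S k' k) (fun _ K => hrate_S K) (fun _ K => hlin_S K)⟩

/-- The bare ROOT-C OF RECORD on the datum (W18's `dressedStabilityStrict_towerC` statement, reached through the same-lattice face). -/
example : DressedStabilityStrict towerC ((2 : ℝ) ^ 4) := sameLatticeFace_fires.2
/-- HEADLINE through N0f's corollary `dressedStability_of_sameLattice_strict` BY NAME. -/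
example : DressedStability towerC := dressedStability_of_sameLattice_strict towerC (L := 2) sameLatticeFace_fires.2
/-- ROOT-B through N0f's `dressedBudget_of_sameLattice_strict` BY NAME with W18's count `1·16^(k−j)` — the END's own Λ (k4). -/
example {wt : Unit → ℕ → ℕ → ℝ} {wbar : ℝ} (hwbar : 0 ≤ wbar)
    (hw0 : ∀ p K, ∀ j ≤ K, 0 ≤ wt p K j) (hwb : ∀ p K, ∀ j ≤ K, wt p K j ≤ wbar) : DressedBudget towerC wt :=
  dressedBudget_of_sameLattice_strict towerC (L := 2) (N₀ := 1) sameLatticeFace_fires.2 zero_le_one hwbar hw0 hwb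
    fun _ K => positionalCount_C K

end Summit.QuantumFields.BalabanUV.T4Continuum.NE1p.DressedSameLatticeWitness

end
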